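import Summits.QuantumFields.BalabanUV.T4Continuum.Support.T4TrajectoryDensityWitness

/-!
# `T4Continuum.T4TrajectoryDensityWitnessK2` (part 2 of 2 of the K = 2 joint inhabitation witness) — booking, trajectory, windows,
# THE 21 BINDERS of `T4TrajectoryDensity.transportsFromVar_of_exponentSlicesAt_lattice` discharged on the toy of part 1, THE
# CONCLUSION BY NAME, and the failure of the v1.1 shapes on the SAME data (tree target `Summits/QuantumFields/BalabanUV/T4Continuum/Support/`;
# cell `pub-balaban`, sub-cell `t4`, spine estimate NE1′, lineage t4-ne1p-p1 generation 20; imports part 1 `T4TrajectoryDensityWitness`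
# ONLY — its module docstring carries the HONEST FRAMING, the WHY and the description of the toy, which govern this part verbatim)

HONEST FRAMING (short form; part 1 in full).  Rung (B)+1 bookkeeping on a FIXED finite torus — NOT infinite volume, NOT a mass gap,
NOT Clay, NOT summit progress.  A TOY: nothing of Bałaban's densities or of (1.73)–(1.75) [Balaban1989LargeFieldII pp. 379–380,
context only] is encoded; whether those densities meet the capstone's shapes is NOT PRINTED and decided nowhere.  [folklore], 0 sorry,
0 citations.

CONTENT.  §4 booking `Bk = T4GatedBooking.oneBirth 2` (one family born at scale 0, `K = 2`, sizes 1), trajectory `Tr` (`lin = [k'=0]`,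
`gen = 80·[k'=0]`), windows `Win k = bondBall 4 (5 − 2k)` (radii 5 ⊋ 3 ⊋ 1), fluctuation support `Dfl = bondBall 4 ½`, the gauge
direction `dir5 = (1/5)·e₀₀`; the binder lemmas `hsl_toy` (birth slices, bound 80), `realBaseAt_toy` (`hB`), `exponentSliceAt_toy`
(`hE`, `Ω = ball 0 (6/N)`, oscillation `≤ 12/500 ≤ ½`), `hlin_toy` (the currency `lin = 1 ≤ 6/5 ≤` oscillation, from part 1's
`osc_ge`), the remaining binders inline (`Gate ≡ True`, `w = r = θ = 1`, `ϱ = 4`, `s = ½`, `α = 2e^{3/2}` with `hdom` an EQUALITY,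
`c_δ = defect = 1/5`, `ψ = 1`, `rel = Eq`, `z₀ = 0`); **`transportsFromVar_K2`**: `Tr.TransportsFromVar (4/5) (fun _ => 2·e^{3/2})
(fun _ => True)` FROM THE CAPSTONE BY NAME, and its reading at `(k', k) = (0, 2)`.  §5 on the SAME data: `not_locallyConst` (the
conclusion of F-g19's `exponent_locallyConst_of_capstone_binders` at `V = z' = 0`, `f = e₀₀` is FALSE — the exponent moves at the
atom `z_H`), `not_realBase` (v1.1's `RealBase` fails on every window of radius `≥ 1`, witness `I·e₀₀`; v1.2's `RealBaseAt Re` holds: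
`realBaseAt_toy`), `Fn_one_zero` / `Fn_one_ne_birth` (the dressing acts: `Fn 0 1 0 = 1/10 ≠ 0 = Fn 0 0 0`).
-/

namespace Summit.QuantumFields.BalabanUV.T4Continuum.T4TrajectoryDensityWitness

open MeasureTheory Set Metric Filter
open Literature.MathematicalPhysics.QuantumFieldTheory.Balaban1983to89
open T4BlockTransport (Fld NDir latMove latN Site norm_dir_le)
open T4BirthChartTransport (GaugeInvariant BirthSlice RelGauge)
open T4TrajectoryComparison (Trajectory RanBelow stepProd)
open T4TrajectoryModulus (bondBall bondBall_add_mem bondBall_latMove_add_mem bondBall_diam)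
open T4TrajectoryDensity

noncomputable section

/-! ## §4 Booking, trajectory, windows; the 21 binders; THE CONCLUSION BY NAME [folklore] -/

/-- The booking: one family born at scale `0`, `K = 2`, all sizes `1`. [folklore] -/
def Bk : T4TermFormat.Booking := T4GatedBooking.oneBirth 2

/-- The booked sizes `lin = [k' = 0]`. [folklore] -/
def linT (k' : ℕ) : ℝ := if k' = 0 then 1 else 0

/-- The generation sizes `gen = 80·[k' = 0]`. [folklore] -/
def genT (k' : ℕ) : ℝ := if k' = 0 then 80 else 0

/-- The booked trajectory over `Bk` (convention (A) with equality: the one generation carries the unit size). [folklore] -/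
def Tr : Trajectory Bk where
  lin := fun _ k' _ => linT k'
  lin_nonneg := fun _ k' _ => by unfold linT; split_ifs <;> norm_num
  gen := fun _ k' => genT k'
  gen_nonneg := fun _ k' => by unfold genT; split_ifs <;> norm_num
  size_le := fun b k _ _ => by
    show (1 : ℝ) ≤ ∑ k' ∈ Finset.Icc 0 k, linT k'
    rw [Finset.sum_eq_single_of_mem 0 (Finset.mem_Icc.mpr ⟨le_rfl, Nat.zero_le k⟩)
      (fun k' _ hk' => by simp [linT, hk'])]
    simp [linT]

/-- The window radii `5 − 2k`. [folklore] -/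
def rad (k : ℕ) : ℝ := 5 - 2 * k

/-- The windows: bond balls of radii `5 ⊋ 3 ⊋ 1` (and empty beyond, never used). [folklore] -/
def Win (k : ℕ) : Set (Fld 4 ℂ) := bondBall 4 (rad k)

/-- The fluctuation support: the bond ball of radius `½` (both atoms inside). [folklore] -/
def Dfl : Set (Fld 4 ℂ) := bondBall 4 (1 / 2)

/-- The gauge direction of the oscillation witness: `(1/5)·e₀₀` with declared bound `1/5`. [folklore] -/
def dir5 : NDir 4 ℂ := fldDir ((1 / 5 : ℂ) • e₀₀) (1 / 5) fun x ν => by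
  rw [Pi.smul_apply, Pi.smul_apply, norm_smul]
  calc ‖(1 / 5 : ℂ)‖ * ‖e₀₀ x ν‖ ≤ ‖(1 / 5 : ℂ)‖ * 1 := by gcongr; exact norm_e₀₀_le x ν
    _ = 1 / 5 := by simp

/-- [folklore] -/
theorem zero_mem_Win {k : ℕ} (hk : k ≤ 2) : (0 : Fld 4 ℂ) ∈ Win k := fun x ν => by
  have : (k : ℝ) ≤ 2 := by exact_mod_cast hk
  simp only [Pi.zero_apply, norm_zero, rad]; linarith

/-- [folklore] -/
theorem zero_mem_Dfl : (0 : Fld 4 ℂ) ∈ Dfl := fun x ν => by simp only [Pi.zero_apply, norm_zero]; norm_num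

/-- [folklore] -/
theorem atomH_mem_Dfl : atomH ∈ Dfl := fun x ν => by simp only [atomH, Complex.norm_real]; norm_num

/-- Closed discs of radius `a/N` about `[0,1]` lie in the open disc of radius `c/N` about `0` (`0 < N ≤ 1`, `a + 1 < c`). [folklore] -/
theorem discs_subset_ball {N a c : ℝ} (hN : 0 < N) (hN1 : N ≤ 1) (hac : a + 1 < c) :
    ∀ x ∈ Icc (0 : ℝ) 1, closedBall (x : ℂ) (a / N) ⊆ ball 0 (c / N) := by
  intro x hx t ht
  rw [mem_closedBall, dist_eq_norm] at ht
  rw [mem_ball, dist_zero_right]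
  have hx' : ‖(x : ℂ)‖ ≤ 1 := by
    rw [Complex.norm_real, Real.norm_eq_abs, abs_le]; constructor <;> linarith [hx.1, hx.2]
  have h1 : (1 : ℝ) ≤ 1 / N := by rw [le_div_iff₀ hN]; linarith
  have h2 : a / N + 1 / N < c / N := by rw [← add_div, div_lt_div_iff_of_pos_right hN]; linarith
  calc ‖t‖ = ‖(t - x) + x‖ := by rw [sub_add_cancel]
    _ ≤ ‖t - (x : ℂ)‖ + ‖(x : ℂ)‖ := norm_add_le _ _
    _ < c / N := by linarith

/-- On the disc of radius `c/N` the chart displacement of `U₀₀` is at most `c`. [folklore] -/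
theorem norm_t_mul_le {c : ℝ} (p : NDir 4 ℂ) (hp : 0 < latN p) {t : ℂ} (ht : t ∈ ball (0 : ℂ) (c / latN p)) :
    ‖t * ev₀₀ p.1.1‖ ≤ c := by
  rw [mem_ball, dist_zero_right] at ht
  rw [norm_mul]
  calc ‖t‖ * ‖ev₀₀ p.1.1‖ ≤ (c / latN p) * latN p :=
        mul_le_mul ht.le (norm_dir_le p 0 0) (norm_nonneg _) ((norm_nonneg t).trans ht.le)
    _ = c := div_mul_cancel₀ _ hp.ne'

/-- `hsl`: the birth slices — `10·U₀₀` is entire along every chart and bounded by `80` on the discs over the radius-5 window;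
the absent later generations are `0`. [folklore] -/
theorem hsl_toy : ∀ (b : Bk.Birth) (k' : ℕ), Bk.birthScale b ≤ k' → k' ≤ Bk.K → RanBelow (fun _ => True) k' →
    BirthSlice (Fn k' k') latMove latN (Win k') 1 1 (genT k') := by
  intro b k' _ _ _ U hU p hp hp1
  rw [Fn_self]
  by_cases hk : k' = 0
  · subst hk
    have hU5 : ‖ev₀₀ U‖ ≤ 5 := by simpa [rad, ev₀₀] using hU 0 0
    refine ⟨ball 0 (3 / latN p), ?_, fun t ht => ?_, discs_subset_ball hp hp1 (by norm_num)⟩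
    · simp only [birth, ↓reduceIte, ev₀₀_latMove]; fun_prop
    · simp only [birth, ↓reduceIte, ev₀₀_latMove, genT]
      have h3 := norm_t_mul_le p hp ht
      calc ‖10 * (ev₀₀ U + t * ev₀₀ p.1.1)‖ = 10 * ‖ev₀₀ U + t * ev₀₀ p.1.1‖ := by rw [norm_mul]; simp
        _ ≤ 10 * (‖ev₀₀ U‖ + ‖t * ev₀₀ p.1.1‖) := by gcongr; exact norm_add_le _ _
        _ ≤ 80 := by linarith
  · exact ⟨univ, by simp only [birth, if_neg hk]; fun_prop, fun t _ => by simp [birth, hk, genT], fun _ _ => subset_univ _⟩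

/-- `hB`: the real regular REFERENCE — at `Re U₀` the exponent is real at both atoms; everything is integrable. [folklore] -/
theorem realBaseAt_toy (S : Set (Fld 4 ℂ)) : RealBaseAt ref₁ base₁ 𝒜₁ flTwo S := by
  refine ⟨Eventually.of_forall fun _ => zero_le_one, ?_, fun U₀ _ => ⟨aesm_two _, ?_, integrable_two _⟩⟩
  · rw [show Function.support base₁ = univ from Function.support_const one_ne_zero]
    simp [flTwo]
  · rw [ae_two]; simp [𝒜₁, ev₀₀_ref₁, Complex.mul_im, Complex.mul_re]

/-- `hE`: the exponent slice ABOUT THE REFERENCE on a window of radius `≤ 3`: `Ω = ball 0 (6/N)`, holomorphy of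
`t ↦ (U₀₀ + t·p₀₀)·z₀₀/10`, oscillation `≤ (3 + 6 + 3)/500 ≤ ½` at the atom `z_H` (and `0` at the atom `0`). [folklore] -/
theorem exponentSliceAt_toy {ρ : ℝ} (hρ : ρ ≤ 3) : ExponentSliceAt ref₁ 𝒜₁ flTwo latMove latN (bondBall 4 ρ) 1 4 (1 / 2) := by
  intro U₀ hU₀ p hp hp1
  have hu : ‖ev₀₀ U₀‖ ≤ 3 := (hU₀ 0 0).trans hρ
  refine ⟨ball 0 (6 / latN p), isOpen_ball, discs_subset_ball hp hp1 (by norm_num), fun t _ => aesm_two _,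
    Eventually.of_forall fun z => ?_, ae_two.mpr ⟨fun t _ => by simp [𝒜₁], fun t ht => ?_⟩⟩
  · show DifferentiableOn ℂ (fun t => 𝒜₁ (latMove U₀ p t) z) _
    simp only [𝒜₁, ev₀₀_latMove]; fun_prop
  · have h6 := norm_t_mul_le p hp ht
    have hre : ‖(((ev₀₀ U₀).re : ℝ) : ℂ)‖ ≤ 3 := by
      rw [Complex.norm_real, Real.norm_eq_abs]; exact (Complex.abs_re_le_norm _).trans hu
    rw [show 𝒜₁ (latMove U₀ p t) atomH - 𝒜₁ (ref₁ U₀) atomH =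
      ((1 / 10 : ℝ) : ℂ) * ((ev₀₀ U₀ + t * ev₀₀ p.1.1) - (((ev₀₀ U₀).re : ℝ) : ℂ)) * ((1 / 50 : ℝ) : ℂ) by
        rw [𝒜₁, 𝒜₁, ev₀₀_latMove, ev₀₀_ref₁, ev₀₀_atomH]; ring]
    rw [norm_mul, norm_mul, Complex.norm_real, Complex.norm_real]
    have hn : ‖(ev₀₀ U₀ + t * ev₀₀ p.1.1) - (((ev₀₀ U₀).re : ℝ) : ℂ)‖ ≤ 12 :=
      calc _ ≤ ‖ev₀₀ U₀ + t * ev₀₀ p.1.1‖ + ‖(((ev₀₀ U₀).re : ℝ) : ℂ)‖ := norm_sub_le _ _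
        _ ≤ (‖ev₀₀ U₀‖ + ‖t * ev₀₀ p.1.1‖) + ‖(((ev₀₀ U₀).re : ℝ) : ℂ)‖ := by gcongr; exact norm_add_le _ _
        _ ≤ (3 + 6) + 3 := by gcongr
        _ = 12 := by norm_num
    calc ‖(1 / 10 : ℝ)‖ * ‖(ev₀₀ U₀ + t * ev₀₀ p.1.1) - (((ev₀₀ U₀).re : ℝ) : ℂ)‖ * ‖(1 / 50 : ℝ)‖
        ≤ ‖(1 / 10 : ℝ)‖ * 12 * ‖(1 / 50 : ℝ)‖ := by gcongr
      _ ≤ 1 / 2 := by norm_num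

/-- `hlin`: THE TRAJECTORY CURRENCY FROM THE DRESSED FUNCTIONALS — at `k' = 0`, `k ≤ 2`: base `0 ∈ 𝒦`, gauge image
`U₁ = (1/5)·e₀₀` along `dir5` (defect `1/5`), and `lin = 1 ≤ 6/5 ≤ ‖Fn 0 k U₁ − Fn 0 k 0‖` (`osc_ge`); `k' ≥ 1`: `lin = 0`. [folklore] -/
theorem hlin_toy : ∀ (b : Bk.Birth) (k' k : ℕ), Bk.birthScale b ≤ k' → k' ≤ k → k ≤ Bk.K → RanBelow (fun _ => True) k →
    ∀ ε > 0, ∃ U₀ ∈ Win k, ∃ U₁ : Fld 4 ℂ, RelGauge (fun U U' : Fld 4 ℂ => U = U') latMove latN U₀ U₁ (1 / 5 : ℝ) ∧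
      linT k' ≤ ‖Fn k' k U₁ - Fn k' k U₀‖ + ε := by
  intro b k' k _ _ hk _ ε hε
  have hk2 : k ≤ 2 := hk
  refine ⟨0, zero_mem_Win hk2, latMove 0 dir5 1, ⟨dir5, by show (0 : ℝ) < 1 / 5; norm_num, le_rfl, rfl⟩, ?_⟩
  by_cases hk' : k' = 0
  · subst hk'
    have h1 : ev₀₀ (latMove 0 dir5 1) = 1 / 5 := by simp [ev₀₀_latMove, dir5, fldDir]
    have := osc_ge hk2 h1
    simp only [linT, ↓reduceIte]; linarith
  · simp only [linT, if_neg hk']; positivity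

/-- **THE JOINT WITNESS — THE CAPSTONE'S CONCLUSION BY NAME**, every one of its 21 binders discharged on the toy. [folklore] -/
theorem transportsFromVar_K2_raw :
    Tr.TransportsFromVar (4 * (1 / 5) / 1) (fun _ => 1 * (2 * Real.exp (3 * (1 / 2)))) (fun _ => True) :=
  transportsFromVar_of_exponentSlicesAt_lattice (T := Tr) (F := ℂ) (Gate := fun _ => True) (Fn := fun _ k' k => Fn k' k)
    (rel := fun _ _ _ U U' => U = U') (𝒦 := fun _ _ k => Win k) (ref := fun _ => ref₁) (base := fun _ => base₁)
    (𝒜 := fun _ => 𝒜₁) (μ := fun _ => flTwo) (z₀ := fun _ => 0) (D := fun _ => Dfl) (defect := fun _ _ _ => 1 / 5)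
    (cδ := 1 / 5) (ψ := 1) (w := 1) (r := 1) (s := fun _ => 1 / 2) (α := fun _ => 2 * Real.exp (3 * (1 / 2)))
    (θ := fun _ => 1) (ϱ := fun _ _ _ => 4)
    (fun _ => by positivity) one_pos one_pos hsl_toy (fun _ _ _ _ hk'k _ _ U => Fn_succ hk'k U)
    (fun _ _ _ _ _ _ _ _ => mem_bddClass _) (fun _ => ⟨0, zero_mem_Dfl⟩) (fun _ _ _ => by norm_num)
    (fun _ _ k _ _ _ _ => realBaseAt_toy (Win (k + 1)))
    (fun _ _ k _ _ _ _ => exponentSliceAt_toy (by simp only [rad]; push_cast; linarith))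
    (fun _ => by norm_num) (fun _ => ae_two.mpr ⟨zero_mem_Dfl, atomH_mem_Dfl⟩)
    (fun _ _ k _ _ _ => bondBall_add_mem (ρ' := rad (k + 1)) (s := 1 / 2) (ρ := rad k)
      (by simp only [rad]; push_cast; linarith))
    (fun _ _ k _ _ _ => bondBall_latMove_add_mem (ρ' := rad (k + 1)) (w := 1) (s := 1 / 2) (ρ := rad k)
      (by simp only [rad]; push_cast; linarith))
    (fun _ z hz z' hz' x ν => by have h := bondBall_diam (s := 1 / 2) z hz z' hz' x ν; linarith)
    (fun _ => ⟨one_pos, le_rfl⟩) (fun _ _ _ _ _ _ => le_of_eq (by ring)) (fun _ _ _ _ _ h => h ▸ rfl)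
    (fun _ _ _ => by norm_num) (fun _ _ _ _ _ _ => by norm_num) hlin_toy

/-- **THE JOINT WITNESS, constants evaluated**: `lin ≤ (4/5)·∏(2e^{3/2})·gen` along the whole K = 2 trajectory. [folklore] -/
theorem transportsFromVar_K2 : Tr.TransportsFromVar (4 / 5) (fun _ => 2 * Real.exp (3 / 2)) (fun _ => True) := by
  have h := transportsFromVar_K2_raw
  norm_num at h
  exact h

/-- Its reading at `(k', k) = (0, 2)`: the unit booked size against the two-step transport of the birth size `80`. [folklore] -/
example : (1 : ℝ) ≤ 4 / 5 * stepProd (fun _ => 2 * Real.exp (3 / 2)) 0 2 * 80 :=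
  transportsFromVar_K2 () 0 2 le_rfl (by norm_num) le_rfl (fun _ _ => trivial)

/-! ## §5 On the SAME data the v1.1 shapes FAIL: F-g19's conclusion, `RealBase`; and the dressing acts [folklore] -/

/-- F-g19's data at `K = 2`, `(k', k) = (0, 0)`: `V = 0 ∈ 𝒦 b 0 2`, `z' = 0 ∈ D 1`, `f = e₀₀` of sup-norm `≤ w = 1`. [folklore] -/
theorem fg19_data : (0 : Fld 4 ℂ) ∈ Win 2 ∧ (0 : Fld 4 ℂ) ∈ Dfl ∧ ∀ x ν, ‖e₀₀ x ν‖ ≤ (1 : ℝ) :=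
  ⟨zero_mem_Win le_rfl, zero_mem_Dfl, norm_e₀₀_le⟩

/-- **THE v1.1 DEGENERACY FAILS ON THE TOY**: the conclusion of `exponent_locallyConst_of_capstone_binders` (F-g19) at these data
is FALSE — the exponent moves at the atom `z_H` (`𝒜 e₀₀ z_H = 1/500 ≠ 0 = 𝒜 0 z_H`). [folklore] -/
theorem not_locallyConst : ¬ (∀ᵐ z ∂flTwo, 𝒜₁ ((0 : Fld 4 ℂ) + 0 + e₀₀) z = 𝒜₁ ((0 : Fld 4 ℂ) + 0) z) := by
  rw [ae_two]; norm_num [𝒜₁]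

/-- **v1.1's `RealBase` FAILS on every window of radius `≥ 1`**: at `U₀ = I·e₀₀`, `Im 𝒜 U₀ z_H = 1/500 ≠ 0` at an atom —
while v1.2's `RealBaseAt Re` holds on every window (`realBaseAt_toy`). [folklore] -/
theorem not_realBase {ρ : ℝ} (hρ : 1 ≤ ρ) : ¬ RealBase base₁ 𝒜₁ flTwo (bondBall 4 ρ) := by
  intro h
  have hI : (Complex.I • e₀₀ : Fld 4 ℂ) ∈ (bondBall 4 ρ : Set (Fld 4 ℂ)) := fun x ν => by
    rw [Pi.smul_apply, Pi.smul_apply, norm_smul, Complex.norm_I, one_mul]; exact (norm_e₀₀_le x ν).trans hρ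
  have him := (h.2.2 _ hI).2.1
  rw [ae_two] at him
  norm_num [𝒜₁, Complex.mul_im, Complex.mul_re] at him

/-- **THE DRESSING ACTS**: `Fn 0 1 0 = 1/10` (`λ(0) = ½`) … [folklore] -/
theorem Fn_one_zero : Fn 0 1 (0 : Fld 4 ℂ) = 1 / 10 := by
  rw [Fn_one (by simp), lam₁, expWeight_atomH]
  norm_num [𝒜₁]

/-- … whereas `Fn 0 0 0 = 0`: the first dressed generation is NOT its birth functional. [folklore] -/
theorem Fn_one_ne_birth : Fn 0 1 ≠ Fn 0 0 := fun h => by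
  have h0 := congrFun h 0
  rw [Fn_one_zero, Fn_zero_zero, ev₀₀_zero, mul_zero] at h0
  norm_num at h0

end

end Summit.QuantumFields.BalabanUV.T4Continuum.T4TrajectoryDensityWitness
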